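import Summits.FinalStateConjecture.FinalStateConjecture.Theorems.SwallowTheDatumSubdataDevelopmentsEmbedSkeleton2
import Summits.FinalStateConjecture.FinalStateConjecture.Theorems.SwallowTheDatumSubdataDevelopmentsEmbedNcbReduction

/-!
# Route SwallowTheDatum · item `SubdataDevelopmentsEmbed` (stmt-FinalStateConjecture-10053) —
# the item from the SAME inputs as the existence of the MGHD

Sequel to `…Skeleton2` and `…NcbReduction`. `…Skeleton2` reduced the item to (a) local geometric
uniqueness, (b) the Cauchy region of the sub-datum and (c) the relative "no corresponding boundary
points" statement;
`…NcbReduction` derives (b) and (c) from Sbierski's printed SAME-DATA Theorem 12 (the displayed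
input `h12` of `Literature/…/MCGHDNoCorrespondingBoundary.lean` and `MGHDExistenceReduction.lean`),
the global-hyperbolicity consequences displayed by that programme (`SpacelikeBoundaryFuturePoint`)
and the first-order spacelikeness of data hypersurfaces (`SpacelikePieceDomain`). Hence:

* `subdataDevelopmentsEmbed_of_locallyUnique_of_thm12` — **the item follows from the registered
  local-uniqueness fact, the same-data Theorem 12, global hyperbolicity of vacuum Cauchy
  developments (compactness of `J∓(x) ∩ J±(ι X)`, closedness of `≤`)** (the slab condition of
  data hypersurfaces being a theorem, `hslab_holds`) —
  i.e. from the inputs of the existence of the maximal globally hyperbolic development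
  (`MGHDExistenceReduction.lean`) plus two standard facts of causal theory about Cauchy
  developments;
* `subdataDevelopmentsEmbed_of_isCommonDevelopment_of_thm12` — the same with local uniqueness in
  the realised shape `hlocal` of `MGHDExistenceReduction.lean`.

Pure composition; no definition; the only named fact is the registered local-uniqueness statement.
-/

noncomputable section

open Function Set Filter Topology TopologicalSpace
open scoped Manifold ContDiff Topology

namespace Summit.FinalStateConjecture.FinalStateConjecture.Theorems

open Literature.Geometry.Lorentzian SubdataDevelopmentsEmbed

namespace SubdataDevelopmentsEmbed

/-- **Hypothesis `hc` of `…Skeleton2` (the Cauchy region of the sub-datum) from the slab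
condition**: the Cauchy piece domain of `ι(Φ N)` (`exists_cauchyPieceDomain`).
[cite: HawkingEllis1973CUP, §6.5 and Prop. 6.6.3] -/
theorem hc_of_slab
    (hslab : ∀ (X : Type) [TopologicalSpace X] [ChartedSpace E3 X] [IsManifold (𝓡 3) ∞ X]
      [ConnectedSpace X] (D : InitialDataSet (𝓡 3) X) (𝒟 : VacuumCauchyDevelopment D),
      ∀ a ∈ range 𝒟.embed, ∃ ν : TangentSpace (𝓡 4) a,
        𝒟.metric.IsTimelike ν ∧ 𝒟.timeOrientation.IsFutureDirected ν ∧
        ∀ κ : ℝ, 0 < κ → ∀ᶠ σ in 𝓝 a, σ ∈ range 𝒟.embed →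
          |𝒟.metric.val a ν (extChartAt (𝓡 4) a σ - extChartAt (𝓡 4) a a)| ≤
            κ * ‖extChartAt (𝓡 4) a σ - extChartAt (𝓡 4) a a‖) :
    ∀ (X : Type) [TopologicalSpace X] [ChartedSpace E3 X] [IsManifold (𝓡 3) ∞ X]
      [T2Space X] [SecondCountableTopology X] [ConnectedSpace X] (D : InitialDataSet (𝓡 3) X)
      (𝒟 : VacuumCauchyDevelopment D) (N : Type) [TopologicalSpace N] [ChartedSpace E3 N]
      [IsManifold (𝓡 3) ∞ N] [ConnectedSpace N] (Φ : N → X)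
      (hΦ : ContMDiff (𝓡 3) (𝓡 3) (∞ + 1) Φ) (hΦ' : ∀ u, Injective (mfderiv (𝓡 3) (𝓡 3) Φ u)),
      IsOpenEmbedding Φ →
      ∃ V : Opens 𝒟.carrier, IsConnected (V : Set 𝒟.carrier) ∧ (∀ u, 𝒟.embed (Φ u) ∈ V) ∧
        (𝒟.metric.restrict PseudoRiemannianMetric.contMDiff_restrict_holds V).IsCauchyHypersurface
          (𝒟.timeOrientation.restrict PseudoRiemannianMetric.contMDiff_restrict_holds
            𝒟.timeOrientation.contMDiff_restrict_holds V) (Subtype.val ⁻¹' range (𝒟.embed ∘ Φ)) := by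
  intro X _ _ _ _ _ _ D 𝒟 N _ _ _ _ Φ _ _ hΦo
  obtain ⟨n₀⟩ : Nonempty N := inferInstance
  obtain ⟨V, -, hVconn, hι, -, hVC⟩ := exists_cauchyPieceDomain 𝒟 hΦo (hslab X D 𝒟) n₀
  exact ⟨V, hVconn, hι, hVC⟩

/-- **The slab condition holds for every vacuum Cauchy development** (indeed every data
embedding): at `ι(x)` take `ν = ν_x`, the future unit normal (`g(ν, ν) = -1`, future-directed), and
the tangency estimate `DataEmbedding.eventually_abs_val_normal_le` (`CauchyDevelopmentPieceDomain`).
[cite: ONeillSemiRiemannian1983, Ch. 4, p. 98] -/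
theorem hslab_holds :
    ∀ (X : Type) [TopologicalSpace X] [ChartedSpace E3 X] [IsManifold (𝓡 3) ∞ X]
      [ConnectedSpace X] (D : InitialDataSet (𝓡 3) X) (𝒟 : VacuumCauchyDevelopment D),
      ∀ a ∈ range 𝒟.embed, ∃ ν : TangentSpace (𝓡 4) a,
        𝒟.metric.IsTimelike ν ∧ 𝒟.timeOrientation.IsFutureDirected ν ∧
        ∀ κ : ℝ, 0 < κ → ∀ᶠ σ in 𝓝 a, σ ∈ range 𝒟.embed →
          |𝒟.metric.val a ν (extChartAt (𝓡 4) a σ - extChartAt (𝓡 4) a a)| ≤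
            κ * ‖extChartAt (𝓡 4) a σ - extChartAt (𝓡 4) a a‖ := by
  intro X _ _ _ _ D 𝒟
  rintro _ ⟨x, rfl⟩
  refine ⟨𝒟.normal x, ?_, 𝒟.isFutureUnitNormal.2 x,
    fun κ hκ ↦ 𝒟.toDataEmbedding.eventually_abs_val_normal_le x hκ⟩
  show 𝒟.metric.val (𝒟.embed x) (𝒟.normal x) (𝒟.normal x) < 0
  rw [𝒟.isFutureUnitNormal.1.val_self x]
  norm_num

end SubdataDevelopmentsEmbed


/-- **`SubdataDevelopmentsEmbed` from local geometric uniqueness (registered fact), the same-data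
Theorem 12 and global hyperbolicity of vacuum Cauchy developments.** [cite: Sbierski2016AHP, Thm. 2.4(ii), §3.2 Thm. 12 and §3.3; HawkingEllis1973CUP, §7.5–7.6, pp. 248–251] -/
theorem subdataDevelopmentsEmbed_of_locallyUnique_of_thm12
    (h : hawkingEllis_locallyUnique_vacuumDevelopment)
    (h12 : ∀ (N : Type) [TopologicalSpace N] [ChartedSpace E3 N] [IsManifold (𝓡 3) ∞ N]
      [ConnectedSpace N] (D₁ : InitialDataSet (𝓡 3) N) (𝒟₁ 𝒟₂ : VacuumCauchyDevelopment D₁)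
      (𝔠 : CauchyDevelopment.CommonDevelopment 𝒟₁.toCauchyDevelopment 𝒟₂.toCauchyDevelopment),
      𝔠.HasCorrespondingBoundaryPoints →
        ∃ V : Opens 𝒟₁.carrier,
          𝒟₁.toCauchyDevelopment.IsCommonDevelopment 𝒟₂.toDataEmbedding V ∧ 𝔠.opens < V)
    (hGH : ∀ (X : Type) [TopologicalSpace X] [ChartedSpace E3 X] [IsManifold (𝓡 3) ∞ X]
      [ConnectedSpace X] (D : InitialDataSet (𝓡 3) X) (𝒟 : VacuumCauchyDevelopment D),
      (∀ x : 𝒟.carrier, IsCompact (𝒟.metric.causalPast 𝒟.timeOrientation {x} ∩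
        𝒟.metric.causalFuture 𝒟.timeOrientation (range 𝒟.embed))) ∧
      (∀ x : 𝒟.carrier, IsCompact (𝒟.metric.causalFuture 𝒟.timeOrientation {x} ∩
        𝒟.metric.causalPast 𝒟.timeOrientation (range 𝒟.embed))) ∧
      (∀ (xs ys : ℕ → 𝒟.carrier) (x y : 𝒟.carrier), Tendsto xs atTop (𝓝 x) →
        Tendsto ys atTop (𝓝 y) →
        (∀ j, ys j ∈ 𝒟.metric.causalFuture 𝒟.timeOrientation {xs j}) →
        y ∈ 𝒟.metric.causalFuture 𝒟.timeOrientation {x})) :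
    Summit.FinalStateConjecture.FinalStateConjecture.Theses.SwallowTheDatum.SubdataDevelopmentsEmbed :=
  subdataDevelopmentsEmbed_of_locallyUnique_of_cauchyRegion_of_ncb h (hc_of_slab hslab_holds)
    (hncb_of_thm12 h12 hGH hslab_holds)

/-- **The same with local uniqueness in the realised shape `hlocal`** of
`MGHDExistenceReduction.lean` (any two vacuum developments of the same data have a common
globally hyperbolic development `U ⊆ M₁`). [cite: Sbierski2016AHP, Thm. 2.4(ii), §3.2 Thm. 12 and §3.3] -/
theorem subdataDevelopmentsEmbed_of_isCommonDevelopment_of_thm12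
    (hlocal : ∀ (N : Type) [TopologicalSpace N] [ChartedSpace E3 N] [IsManifold (𝓡 3) ∞ N]
      [ConnectedSpace N] (D₁ : InitialDataSet (𝓡 3) N) (𝒟₁ 𝒟₂ : VacuumCauchyDevelopment D₁),
      ∃ U : Opens 𝒟₁.carrier, 𝒟₁.toCauchyDevelopment.IsCommonDevelopment 𝒟₂.toDataEmbedding U)
    (h12 : ∀ (N : Type) [TopologicalSpace N] [ChartedSpace E3 N] [IsManifold (𝓡 3) ∞ N]
      [ConnectedSpace N] (D₁ : InitialDataSet (𝓡 3) N) (𝒟₁ 𝒟₂ : VacuumCauchyDevelopment D₁)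
      (𝔠 : CauchyDevelopment.CommonDevelopment 𝒟₁.toCauchyDevelopment 𝒟₂.toCauchyDevelopment),
      𝔠.HasCorrespondingBoundaryPoints →
        ∃ V : Opens 𝒟₁.carrier,
          𝒟₁.toCauchyDevelopment.IsCommonDevelopment 𝒟₂.toDataEmbedding V ∧ 𝔠.opens < V)
    (hGH : ∀ (X : Type) [TopologicalSpace X] [ChartedSpace E3 X] [IsManifold (𝓡 3) ∞ X]
      [ConnectedSpace X] (D : InitialDataSet (𝓡 3) X) (𝒟 : VacuumCauchyDevelopment D),
      (∀ x : 𝒟.carrier, IsCompact (𝒟.metric.causalPast 𝒟.timeOrientation {x} ∩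
        𝒟.metric.causalFuture 𝒟.timeOrientation (range 𝒟.embed))) ∧
      (∀ x : 𝒟.carrier, IsCompact (𝒟.metric.causalFuture 𝒟.timeOrientation {x} ∩
        𝒟.metric.causalPast 𝒟.timeOrientation (range 𝒟.embed))) ∧
      (∀ (xs ys : ℕ → 𝒟.carrier) (x y : 𝒟.carrier), Tendsto xs atTop (𝓝 x) →
        Tendsto ys atTop (𝓝 y) →
        (∀ j, ys j ∈ 𝒟.metric.causalFuture 𝒟.timeOrientation {xs j}) →
        y ∈ 𝒟.metric.causalFuture 𝒟.timeOrientation {x})) :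
    Summit.FinalStateConjecture.FinalStateConjecture.Theses.SwallowTheDatum.SubdataDevelopmentsEmbed :=
  subdataDevelopmentsEmbed_of_isCommonDevelopment_of_cauchyRegion_of_ncb hlocal (hc_of_slab hslab_holds)
    (hncb_of_thm12 h12 hGH hslab_holds)

end Summit.FinalStateConjecture.FinalStateConjecture.Theorems

end
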